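import Summits.ResolutionOfSingularities.ResolutionOfSingularities.Theorems.HilbertSamuelEliminationSigmaMaxModificationsCorridor3SigmaIsoBoundaryDefs
import Summits.ResolutionOfSingularities.ResolutionOfSingularities.Theorems.HilbertSamuelEliminationSigmaMaxModificationsCorridor3WLadderStrataClean
import HarnessLib

/-!
# [OURS · L1 W4.2] `Corridor3WLadderHybridLowCleanDefs` — the two From-`s₀` binder rows of the (c-reg) SUPPLIER of the strategy-generic
# LOW ADAPTER: (K-ctr)From «clean members over the centre» and (π-fin)From «late policy centres miss the chain point», for an ARBITRARY
# boundary-reading strategy `σ` (and policy `π`) from a start state `s₀`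

Crux chain w42 (`SigmaMaxModifications`, stmt-ResolutionOfSingularities-18506; conjunct `SigmaMaxModificationsCorridor3`,
stmt-ResolutionOfSingularities-19249), res-L1-w42-plan-1 RULINGS v3.14-21 (FS), v3.14-22 (FW), v3.14-35 (HR) («§3 ORDER: (c-rep) → (c-reg) → (b) →
Seg-E»). Typer res-type-040 (gen 19). DEFINITIONS ONLY (two `def … : Prop` rows, OPEN obligations-as-binders; nothing is claimed). OURS (cell
res-hironaka, slot W4.2); NOT statements of H. Hironaka's manuscript [Hironaka2017] nor of [CossartJannsenSaito2020]; AI-typed, weaker than expert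
review. Helper vocabulary `--supports stmt-ResolutionOfSingularities-19249 --as helper` (counted 0).

WHY THESE ROWS. The Low class of res-D-pv-047's E7 for the menu hybrid `σ_h = π.hybrid (ofStageOracleE ω)` is reduced (p536342, p535770, p537833,
p538985) to the named rows (c-reg)From `StrataCycleStartRegularFromσE` (p537475), (c-menu)From and the units half. Stub-4 discharged the CJS row
(c-reg) (`Moving.strataCycleStartRegular_of_clean`, `…WLadderStrataCycleStart`) from the two ONE-STEP kernels (K-ctr) `Moving.StrataCentreMembersClean`
and (K-str) `Moving.StrataStrictTransformClean` by the label-clean calculus and the count «each old label offers at most one unclean late cycle start,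
because its cycle runs to the END step». For the hybrid with CYCLE ATOMICITY (res-L1-type-o1 15:21:10Z `StrategyE.betweenCycles`: the policy is
silent while a fallback cycle is pending; policy steps emit `P' = none`, (FW) β) the count ports verbatim (`…WLadderHybridLowRegular`) except for one
hybrid-specific case: an infinite tail of POLICY steps at states whose treated label is an unclean old label — excluded for MOVING chains by
(π-fin)From (plan-1 / o1 (D-i): the policy touches a W-low point finitely often). (K-str) is strategy-free (stub-4's
`isRegular_and_dim_le_one_strictTransform_blowup`, `eq_strictTransformSet_blowup`) and is PROVED for σE-steps in `…WLadderHybridLowStrict`; the two rows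
below are what remains as input. (Without atomicity the count needs instead a «curves at the chain point» row and Krull's blow-up tower of a reduced
excellent one-dimensional local ring, Kollár 2007 Thm. 1.101, tree `Kollar2007_thm_1_101_localChain_holds` — not pursued.)

* (K-ctr)From `StrataCentreMembersCleanFromσE σ N ν s₀ G` — From-`s₀` σE-copy of `Moving.StrataCentreMembersClean` (p518012's kernel), every
  σ-step (policy or fallback): «`x_n ∈` centre ⇒ the components of `X_{n+1}(ν)` through `x_{n+1}` mapping into the centre are at most one and a
  regular curve at `x_{n+1}` (`Moving.IsRegularCurveAt`)». Intended discharge as stub-4's (Thm. 3.14 point-centre locus / near-fibre form, Thm. 3.6,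
  Prop. 6.31; res-type-038's (K-ctr-cv) `…WLadderStrataCentreDispatch`).
* (π-fin)From `StrataPolicyMissesFromσE π σ N ν s₀ G` — «from some stage on no step the POLICY `π` proposes at the state of `X_n` has a centre
  containing `x_n`» (plan-1/res-L1-type-o1 (D-i): «π touches a W-low point only inside PHASE S/B′ prep, finitely often per object», with
  `finiteHits_of_componentCarrier`, p533837).

Both rows quantify over chains `c` with `ReachesσE σ N ν s₀ (c 0)` (tails allowed), grade `G`, never isolated, moving — the shape of
`NoMovingNearChainFromσE` (p523041) and of (b)From/(c-swallow)From (p533838); each is inherited by σ-reached states and smaller grades.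

References: CJS LNM 2270 Rem. 6.29 (1), Thm. 3.6, Thm. 3.14, Prop. 6.31 [CossartJannsenSaito2020]; tree `…WLadderStrataClean` (p518012:
`IsRegularCurveAt`, `LabelCleanAt`, `StrataCentreMembersClean`), `…SigmaBoundaryDefs` (p523041), `…SigmaIsoBoundaryDefs` (p528217: `StepProjectionσE`).
-/

noncomputable section

set_option linter.dupNamespace false

open CategoryTheory AlgebraicGeometry TopologicalSpace Topology
open Summit.ResolutionOfSingularities.ResolutionOfSingularities.Theorems.CampaignW42
open Literature.AlgebraicGeometry.Resolution Literature.RingTheory.HilbertSamuel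
open Summit.ResolutionOfSingularities.ResolutionOfSingularities.Theorems.SigmaMaxModificationsCorridor3
open Summit.ResolutionOfSingularities.ResolutionOfSingularities.Theorems.SigmaMaxModificationsCorridor3.Moving

namespace Summit.ResolutionOfSingularities.ResolutionOfSingularities.Theorems.SigmaMaxModificationsCorridor3.Sigma

universe u

/-- [OURS · L1 W4.2] **ROW (K-ctr)From — OVER A BLOWN-UP CHAIN POINT THE COMPONENTS THROUGH `x_{n+1}` MAPPING INTO THE CENTRE ARE CLEAN, from `s₀`,
for the boundary-reading strategy `σ`** (From-`s₀` σE-copy of stub-4's `Moving.StrataCentreMembersClean`): along every moving, never-isolated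
`G`-chain of σE-steps whose start is σ-reached from `s₀`, from some stage on, at every step `σ` allows at the state of `X_n` whose centre `C`
contains `x_n`, read through the step projection `f : X_{n+1} → X_n` of the chain, the irreducible components `Z'` of `X_{n+1}(ν)` through `x_{n+1}`
with `f(Z') ⊆ V(C)` number AT MOST ONE, and such a `Z'` is a regular curve at `x_{n+1}` (`Moving.IsRegularCurveAt`). OURS row, OPEN as a binder;
NOT a statement of the manuscript. [cite: CossartJannsenSaito2020, Thm. 3.14, Thm. 3.6, Prop. 6.31] -/
def StrataCentreMembersCleanFromσE (σ : StrategyE.{u}) (N : ℕ) (ν : ℕ → ℕ) (s₀ : MarkedStageE.{u}) (G : MarkedStage.{u} → Prop) :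
    Prop :=
  ∀ c : ℕ → MarkedStageE.{u}, ReachesσE σ N ν s₀ (c 0) → (∀ n, CanonicalNearStepσE σ N ν (c n) (c (n + 1))) →
    (∀ n, G (c n).toMarkedStage) → (∀ n, ¬ Iso N (c n).toMarkedStage) → (∀ n, ∃ m, n ≤ m ∧ (c m).IsBlownUpσE σ N ν) →
    ∃ n₁, ∀ n, n₁ ≤ n → ∀ (C : (c n).W.IdealSheafData) (P' : Option (Pending (blowup C))),
      σ.step (c n).W (c n).ln N ν (c n).L (c n).P (c n).E C P' → (c n).pt ∈ (C.support : Set (c n).W) →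
      ∀ f : (c (n + 1)).W ⟶ (c n).W, StepProjectionσE σ N ν (c n) (c (n + 1)) f →
        (∀ Z' ∈ componentsThrough N ν (c (n + 1)).toMarkedStage, ∀ Z'' ∈ componentsThrough N ν (c (n + 1)).toMarkedStage,
            f.base '' Z' ⊆ (C.support : Set (c n).W) → f.base '' Z'' ⊆ (C.support : Set (c n).W) → Z' = Z'') ∧
        ∀ Z' ∈ componentsThrough N ν (c (n + 1)).toMarkedStage, f.base '' Z' ⊆ (C.support : Set (c n).W) →
          IsRegularCurveAt (c (n + 1)).toMarkedStage Z'

/-- [OURS · L1 W4.2] **ROW (π-fin)From — LATE POLICY CENTRES MISS THE CHAIN POINT, from `s₀`, for the policy `π` along `σ`-chains**: along every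
moving, never-isolated `G`-chain of σE-steps whose start is σ-reached from `s₀`, from some stage on no step the POLICY `π` proposes at the state of
`X_n` has a centre containing `x_n` (plan-1 / res-L1-type-o1 (D-i): the policy touches a W-low point finitely often). OURS row, OPEN as a binder;
NOT a statement of the manuscript. [cite: CossartJannsenSaito2020, Rem. 6.29 (1)] -/
def StrataPolicyMissesFromσE (π σ : StrategyE.{u}) (N : ℕ) (ν : ℕ → ℕ) (s₀ : MarkedStageE.{u}) (G : MarkedStage.{u} → Prop) : Prop :=
  ∀ c : ℕ → MarkedStageE.{u}, ReachesσE σ N ν s₀ (c 0) → (∀ n, CanonicalNearStepσE σ N ν (c n) (c (n + 1))) →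
    (∀ n, G (c n).toMarkedStage) → (∀ n, ¬ Iso N (c n).toMarkedStage) → (∀ n, ∃ m, n ≤ m ∧ (c m).IsBlownUpσE σ N ν) →
    ∃ n₁, ∀ n, n₁ ≤ n → ∀ (C : (c n).W.IdealSheafData) (P' : Option (Pending (blowup C))),
      π.step (c n).W (c n).ln N ν (c n).L (c n).P (c n).E C P' → (c n).pt ∉ (C.support : Set (c n).W)

variable {π σ : StrategyE.{u}} {N : ℕ} {ν : ℕ → ℕ} {s₀ s₁ : MarkedStageE.{u}} {G G' : MarkedStage.{u} → Prop}

/-- (K-ctr)From is inherited by σ-reached states and by smaller grades. [folklore] -/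
theorem StrataCentreMembersCleanFromσE.of_reaches_mono (h : StrataCentreMembersCleanFromσE σ N ν s₀ G) (hr : ReachesσE σ N ν s₀ s₁)
    (hG : ∀ s, G' s → G s) : StrataCentreMembersCleanFromσE σ N ν s₁ G' :=
  fun c h0 hstep hG' hnI hmov => h c (hr.trans h0) hstep (fun n => hG _ (hG' n)) hnI hmov

/-- (π-fin)From is inherited by σ-reached states and by smaller grades. [folklore] -/
theorem StrataPolicyMissesFromσE.of_reaches_mono (h : StrataPolicyMissesFromσE π σ N ν s₀ G) (hr : ReachesσE σ N ν s₀ s₁)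
    (hG : ∀ s, G' s → G s) : StrataPolicyMissesFromσE π σ N ν s₁ G' :=
  fun c h0 hstep hG' hnI hmov => h c (hr.trans h0) hstep (fun n => hG _ (hG' n)) hnI hmov

end Summit.ResolutionOfSingularities.ResolutionOfSingularities.Theorems.SigmaMaxModificationsCorridor3.Sigma

end
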